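import Summits.KontsevichZagierPeriods.KontsevichZagierPeriods.Theorems.FermatIsogenyBetaLinearSectorSixthsStubIsogenyNeg
import Summits.KontsevichZagierPeriods.KontsevichZagierPeriods.Theorems.FermatIsogenyBetaLinearSectorSixthsStubIsogenyMid
import Summits.KontsevichZagierPeriods.KontsevichZagierPeriods.Theorems.FermatIsogenyBetaLinearSectorSixthsStubIsogenyPos
import HarnessLib

/-!
# `BetaLinearSector` (stmt-KontsevichZagierPeriods-3897), line `fermat-sector-transport` —
# stub `stub_isoThree_secondKind_tail` (second-kind pull-back along the real 3-isogeny, arc `(2, ∞)`)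

Level `6` of the crux `BetaLinearSector` (route FermatIsogeny) needs, inside the Kontsevich–Zagier
calculus of moves (`KZ.Equivalent`), links among the ten Beta cells of the class `π²/Γ(1/3)³`.
These are periods of the SECOND kind of the CM curves `E₊ : y² = x³ + 1` and `E₋ : Y² = X³ − 1`,
transported by the REAL `3`-ISOGENY `ψ : E₊ → E₋` exactly as the first-kind periods
(`stub_isogenyThree_piece_pos`): the `x`-map is `X(x) = (x³ + 4)/(3x²)`, `X′(x) = (x³ − 8)/(3x³)`,
`(x³ + 4)³ − 27x⁶ = (x³ + 1)(x³ − 8)²`, `ψ^*(dX/Y) = √3·dx/y`. For the second-kind form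
`dX/(X²Y)` the rule-(2) Jacobian identity is the first-kind one (`isoPos_jacobian`) multiplied by
`1/X(x)² = 9x⁴/(x³ + 4)²`:

  `(1/(X²√(X³ − 1)))·|X′| = 9√3·x⁴/((x³ + 4)²·√(x³ + 1))`   (`isoSK_pos_jacobian`).

On the UNBOUNDED arc `(2, ∞)` the map `X` is a pole-free `ℚ`-rational function, injective with
derivative `X′ > 0`, and `X((2, ∞)) = (1, ∞)` (`isoPos_xMap_injective`, `isoPos_hasDerivAt_xMap`,
`isoPos_image_xMap`, all landed with the first-kind stub). Hence for
`S = [(2, ∞), 9√3x⁴/((x³+4)²√(x³+1))]` and `T = [(1, ∞), 1/(X²√(X³−1))]` (integrands prescribed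
on the domains only) `[S] − [T]` is ONE change-of-variables move, packaged in `ℝ¹` by
`of_sub_of_mem_changeOfVariablesRel_dimOne` (`stub_isoThree_secondKind_tail`). The two bounded
arcs `(−1, 0)`, `(0, 2)` are the neighbouring stub `stub_isoThree_secondKind_arcs`.

References: M. Kontsevich, D. Zagier, *Periods* (2001), §1.2 rule (2); J. H. Silverman,
*The Arithmetic of Elliptic Curves* (2009), III.4 (Vélu's `3`-isogeny with kernel the flexes
`(0, ±1)` of `y² = x³ + 1`).
-/

noncomputable section

namespace Summit.KontsevichZagierPeriods.FermatIsogeny.BetaLinearSector.Sixths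

open Set MeasureTheory
open MvPolynomial (aeval X C)
open Literature.NumberTheory.Transcendental
open Summit.KontsevichZagierPeriods.HermiteRigidity.CMTwistQuasiPeriodTransfer
  (of_sub_of_mem_changeOfVariablesRel_dimOne image_fin_one)
open Summit.KontsevichZagierPeriods.KontsevichZagierPeriods.Theorems.GKZLevelThree
  (isSemialgebraicFunOn_ratFun₁)

/-! ## The second-kind Jacobian identity on `(2, ∞)` -/

/-- **The rule-2 integrand identity for the second-kind form on `(2, ∞)`**:
`9√3·x⁴/((x³ + 4)²·√(x³ + 1)) = (1/(X(x)²·√(X(x)³ − 1)))·|X′(x)|`, i.e. the first-kind identity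
`√3/√(x³+1) = (1/√(X³−1))·|X′|` (`isoPos_jacobian`) multiplied by `1/X(x)² = 9x⁴/(x³ + 4)²`
(`ψ^*(dX/(X²Y)) = 9√3·x⁴dx/((x³+4)²y)`). [cite: KontsevichZagier2001, §1.2 rule (2)] -/
theorem isoSK_pos_jacobian {x : ℝ} (hx : 2 < x) :
    9 * Real.sqrt 3 * x ^ 4 / ((x ^ 3 + 4) ^ 2 * Real.sqrt (x ^ 3 + 1)) =
      1 / (((x ^ 3 + 4) / (3 * x ^ 2)) ^ 2 * Real.sqrt (((x ^ 3 + 4) / (3 * x ^ 2)) ^ 3 - 1)) *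
        |(x ^ 3 - 8) / (3 * x ^ 3)| := by
  have hJ := isoPos_jacobian hx
  set φ : ℝ := (x ^ 3 + 4) / (3 * x ^ 2) with hφ
  set R : ℝ := Real.sqrt (φ ^ 3 - 1) with hR
  set A : ℝ := |(x ^ 3 - 8) / (3 * x ^ 3)| with hA
  rw [show 1 / (φ ^ 2 * R) * A = 1 / φ ^ 2 * (1 / R * A) by ring, ← hJ, hφ, div_pow, one_div_div,
    div_mul_div_comm]
  ring

/-! ## The registered stub: the arc `(2, ∞)` by ONE change of variables -/

/-- **Stub `stub_isoThree_secondKind_tail`** (line `fermat-sector-transport` of `BetaLinearSector`,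
level `6`): on the unbounded arc `(2, ∞)` of `y² = x³ + 1`, any representations
`S = [(2, ∞), 9√3x⁴/((x³+4)²√(x³+1))]` and `T = [(1, ∞), 1/(X²√(X³−1))]` (integrands prescribed
on the domains only) are `KZ.Equivalent`: ONE change-of-variables move (Kontsevich–Zagier rule
(2)) along the `x`-map `X = (x³+4)/(3x²)` of the real `3`-isogeny `y² = x³ + 1 → Y² = X³ − 1`
(a `ℚ`-rational function, pole-free, injective and with derivative `(x³−8)/(3x³) > 0` on
`(2, ∞)`, image `(1, ∞)`), which pulls the second-kind form `dX/(X²Y)` back to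
`9√3·x⁴dx/((x³+4)²y)` (`isoSK_pos_jacobian`). [cite: KontsevichZagier2001, §1.2 rule (2)] -/
theorem stub_isoThree_secondKind_tail : ∀ (S T : KZ.IntegralRep 1),
    S.domain = {x | 2 < x 0} →
    Set.EqOn S.integrand (fun x => 9 * Real.sqrt 3 * x 0 ^ 4 / ((x 0 ^ 3 + 4) ^ 2 * Real.sqrt (x 0 ^ 3 + 1))) S.domain →
    T.domain = {x | 1 < x 0} →
    Set.EqOn T.integrand (fun x => 1 / (x 0 ^ 2 * Real.sqrt (x 0 ^ 3 - 1))) T.domain → KZ.Equivalent S T := by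
  intro S T hSd hSi hTd hTi
  set φ : ℝ → ℝ := fun y => (y ^ 3 + 4) / (3 * y ^ 2) with hφ
  set φ' : ℝ → ℝ := fun y => (y ^ 3 - 8) / (3 * y ^ 3) with hφ'
  have hmem : ∀ p ∈ S.domain, 2 < p 0 := fun p hp => by rw [hSd] at hp; exact hp
  refine KZ.changeOfVariablesRel_subset_relations
    (of_sub_of_mem_changeOfVariablesRel_dimOne S T φ φ' ?_ ?_ ?_ ?_ ?_)
  · -- semialgebraic: a `ℚ`-rational function of `p 0`, pole-free on `(2, ∞)`
    refine isSemialgebraicFunOn_ratFun₁ S.isSemialgebraic_domain (X 0 ^ 3 + 4) (3 * X 0 ^ 2) φ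
      (fun p hp => ?_) (fun p _ => ?_)
    · have h0 : (0:ℝ) < p 0 := by linarith [hmem p hp]
      simp only [map_mul, map_pow, MvPolynomial.aeval_X, map_ofNat]
      positivity
    · simp only [hφ, map_mul, map_add, map_pow, MvPolynomial.aeval_X, map_ofNat]
  · -- derivative
    intro p hp
    have h0 : (0:ℝ) < p 0 := by linarith [hmem p hp]
    exact isoPos_hasDerivAt_xMap h0.ne'
  · -- injective
    intro p hp q hq h
    exact isoPos_xMap_injective (hmem p hp) (hmem q hq) h
  · -- image
    rw [hTd, hSd]
    exact (image_fin_one isoPos_image_xMap).symm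
  · -- the second-kind Jacobian identity on the arc
    intro p hp
    have hp' := hmem p hp
    have hφp : (fun _ : Fin 1 => φ (p 0)) ∈ T.domain := by
      rw [hTd]
      exact isoPos_one_lt_xMap hp'
    rw [hSi hp, hTi hφp]
    exact isoSK_pos_jacobian hp'

end Summit.KontsevichZagierPeriods.FermatIsogeny.BetaLinearSector.Sixths

end
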